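import Literature.AlgebraicGeometry.ShimuraVarieties.UnitaryBallLieDerivative
import HarnessLib

/-!
# The Cartan decomposition `𝔲(2,1) = 𝔨 ⊕ 𝔭` of the Lie algebra of `U(2,1)`, and `[𝔭, 𝔭] ⊆ 𝔨`

Topic `AlgebraicGeometry/ShimuraVarieties` (junction with `NumberTheory/Automorphic`); sequel of
`UnitaryBallLieDerivative`, which realises `U(2,1) = {g : gᴴ J g = J}` (`J = diag(1,1,-1)`) as a
linear real group `BallForms.u21Group : RealMatrixGroup ℂ (Fin 3)` with Lie algebra
`𝔲(2,1) = {X : Xᴴ J + J X = 0}` (`BallForms.u21Lie`) and parametrises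
`𝔭 = {X_b = [[0, b], [bᴴ, 0]]}` by `b ∈ ℂ²` (`BallForms.liePMat b`, matrix `pMat b`). Here we record
the Cartan decomposition of `𝔲(2,1)` with respect to the Cartan involution `θ X = -Xᴴ`
(Knapp 2002, I.§1, Example 3 for `U(p,q)`; VI.§2, (6.24): `𝔨 = 𝔤 ∩ 𝔲(N)`, `𝔭 = 𝔤 ∩ {Hermitian}`),
in the vocabulary of `RealMatrixGroup` (`u21Group.compactLie = 𝔲(2,1) ∩ 𝔲(3) = 𝔨`):

* `conjTranspose_mem_u21Lie` — `𝔲(2,1)` is stable under `X ↦ Xᴴ` (hence under `θ`);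
* `sub_conjTranspose_mem_compactLie` — `X - Xᴴ ∈ 𝔨` for `X ∈ 𝔲(2,1)`;
* `eq_pMat_of_conjTranspose_eq` — a HERMITIAN element of `𝔲(2,1)` is `X_b`, `b` its last column
  (it anticommutes with `J`, so its diagonal blocks vanish): `𝔭 = {X_b}`;
* `exists_mem_compactLie_add_pMat` — **`𝔤 = 𝔨 + 𝔭`**: every `X ∈ 𝔲(2,1)` is `K + X_c` with
  `K = ½(X - Xᴴ) ∈ 𝔨`, `X_c = ½(X + Xᴴ)`;
* `pMat_mul_sub_mul_mem_compactLie` — **`[𝔭, 𝔭] ⊆ 𝔨`**: `X_b X_c - X_c X_b ∈ 𝔨`;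
* `exists_compactLie_frame` — the packaging consumed by Nelson's method
  (`Literature.NumberTheory.Automorphic.IsL2LieStable.analyticAt_rightRegular_toLp_of_null`): a
  finite family `Y_a ∈ 𝔨` spanning `𝔨`, which together with `P_j = X_{e_j}` and `Q_j = X_{i e_j}`
  (`j = 0, 1`) spans `𝔲(2,1)` over `ℝ`, and such that every `⁅X_b, X_c⁆` lies in the real span of
  the `Y_a`;
* `mem_compactLie_of_mul_J_eq_J_mul`, `mem_compactLie_iff_mul_J_eq_J_mul` — conversely
  `𝔨 = {Y ∈ 𝔲(2,1) : Y J = J Y}` (bridge between the two spellings of `𝔨`-stability);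
* `z0_eq_smul_one_add_J`, `z0_mem_compactLie`, `z0_mul_eq_mul_z0_of_mem_compactLie`,
  `z0_mul_pMat_sub_pMat_mul_z0` — the element `z₀ = diag(i, i, 0) = (i/2)(1 + J)` of the centre of
  `𝔨` inducing the complex structure of `𝔭 ≅ ℂ²`: `[z₀, K] = 0` for `K ∈ 𝔨` and
  `[z₀, X_b] = X_{ib}` (so `𝔭^± = {X_b ∓ i X_{ib}}` are the `±i`-eigenspaces of `ad z₀` on `𝔭_ℂ`,
  the holomorphic / antiholomorphic tangent directions of the ball at the origin).

Everything is proved; there is no definition (the frame is an existence statement, `z₀` is the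
explicit matrix `Matrix.diagonal ![I, I, 0]`).

## References

* A. W. Knapp, *Lie Groups Beyond an Introduction*, 2nd ed. (2002): I.§1 Example (3) (`𝔲(p,q)`),
  VI.§2 (Cartan decomposition, (6.24)–(6.25)), VII.§9 (Hermitian symmetric case, `ad z₀`)
  [Knapp2002].
* A. Borel, N. Wallach, *Continuous cohomology, discrete subgroups, and representations of
  reductive groups*, 2nd ed. (2000), II.§2–§3 [BorelWallach2000].
-/

set_option autoImplicit false

-- Mathlib idiom (Mathlib/Algebra/Lie/OfAssociative.lean, where `LieRing.ofAssociativeRing` is a `def` made a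
-- local instance file by file); needed to mention Lie subalgebras of matrix algebras
attribute [local instance 100] LieRing.ofAssociativeRing

noncomputable section

open scoped Matrix ComplexConjugate
open Literature.Geometry.ComplexHyperbolic Literature.Geometry.ComplexHyperbolic.BallModel
open Literature.NumberTheory.Automorphic

namespace Literature.AlgebraicGeometry.ShimuraVarieties

namespace BallForms

/-! ### 1. `θ`-stability and the two parts `𝔨`, `𝔭` -/

/-- `𝔲(2,1)` is stable under conjugate transpose: if `Xᴴ J + J X = 0` then `X J + J Xᴴ = 0`
(conjugate the relation by `J`, `J² = 1`). Equivalently `𝔲(2,1)` is stable under the Cartan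
involution `θ X = -Xᴴ`. Knapp 2002, I.§1 Example (3). [cite: Knapp2002, I.§1 Example (3)] -/
theorem conjTranspose_mem_u21Lie {X : Matrix (Fin 3) (Fin 3) ℂ} (hX : X ∈ u21Lie) : Xᴴ ∈ u21Lie := by
  rw [mem_u21Lie_iff] at hX ⊢
  rw [Matrix.conjTranspose_conjTranspose]
  have h := congrArg (fun M => J * M * J) hX
  simp only [Matrix.mul_add, Matrix.add_mul, Matrix.mul_zero, Matrix.zero_mul] at h
  have e1 : J * (Xᴴ * J) * J = J * Xᴴ := by
    rw [← Matrix.mul_assoc J Xᴴ J, Matrix.mul_assoc (J * Xᴴ) J J, J_mul_J, Matrix.mul_one]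
  have e2 : J * (J * X) * J = X * J := by
    rw [← Matrix.mul_assoc J J X, J_mul_J, Matrix.one_mul]
  rw [e1, e2] at h
  rwa [add_comm] at h

/-- **The `𝔨`-part.** For `X ∈ 𝔲(2,1)`, `X - Xᴴ` lies in `𝔨 = 𝔲(2,1) ∩ 𝔲(3)`
(`u21Group.compactLie`): it is in `𝔲(2,1)` by `conjTranspose_mem_u21Lie` and is skew-Hermitian.
Knapp 2002, VI.§2, (6.24)–(6.25). [cite: Knapp2002, VI.§2 (6.25)] -/
theorem sub_conjTranspose_mem_compactLie {X : Matrix (Fin 3) (Fin 3) ℂ} (hX : X ∈ u21Lie) :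
    X - Xᴴ ∈ u21Group.compactLie := by
  rw [RealMatrixGroup.mem_compactLie_iff, u21Group_lie]
  refine ⟨u21Lie.sub_mem hX (conjTranspose_mem_u21Lie hX), ?_⟩
  rw [Matrix.star_eq_conjTranspose, Matrix.conjTranspose_sub, Matrix.conjTranspose_conjTranspose,
    neg_sub]

/-- An element of `𝔨` commutes with `J`: `J K = K J` (from `Kᴴ J + J K = 0` and `Kᴴ = -K`); i.e.
`𝔨` is block diagonal, `𝔨 = 𝔲(2) ⊕ 𝔲(1)`. Knapp 2002, I.§1 Example (3). [cite: Knapp2002, I.§1 Example (3)] -/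
theorem J_mul_eq_mul_J_of_mem_compactLie {K : Matrix (Fin 3) (Fin 3) ℂ} (hK : K ∈ u21Group.compactLie) :
    J * K = K * J := by
  rw [RealMatrixGroup.mem_compactLie_iff, u21Group_lie, mem_u21Lie_iff, Matrix.star_eq_conjTranspose] at hK
  obtain ⟨h1, h2⟩ := hK
  rw [h2, Matrix.neg_mul, neg_add_eq_zero] at h1
  exact h1.symm

/-- **`𝔭 = {X_b}`.** A Hermitian element `X` of `𝔲(2,1)` anticommutes with `J`, so its diagonal
blocks vanish and `X = X_b = pMat b` with `b = (X₀₂, X₁₂)` its last column. Knapp 2002, VI.§2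
(`𝔭` = Hermitian part) and I.§1 Example (3). [cite: Knapp2002, VI.§2 (6.25)] -/
theorem eq_pMat_of_conjTranspose_eq {X : Matrix (Fin 3) (Fin 3) ℂ} (hX : X ∈ u21Lie) (hH : Xᴴ = X) :
    X = pMat ![X 0 2, X 1 2] := by
  rw [mem_u21Lie_iff, hH] at hX
  have hent : ∀ i j : Fin 3,
      X i j * (![1, 1, -1] : Fin 3 → ℂ) j + (![1, 1, -1] : Fin 3 → ℂ) i * X i j = 0 := fun i j => by
    have h := congrFun (congrFun hX i) j
    simpa only [Matrix.add_apply, J, Matrix.mul_diagonal, Matrix.diagonal_mul, Matrix.zero_apply] using h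
  have hherm : ∀ i j : Fin 3, X j i = conj (X i j) := fun i j => by
    have h := congrFun (congrFun hH j) i
    rw [Matrix.conjTranspose_apply] at h
    rw [← h, Complex.star_def]
  have h00 : X 0 0 = 0 := by have h := hent 0 0; simpa using h
  have h01 : X 0 1 = 0 := by have h := hent 0 1; simpa using h
  have h10 : X 1 0 = 0 := by have h := hent 1 0; simpa using h
  have h11 : X 1 1 = 0 := by have h := hent 1 1; simpa using h
  have h22 : X 2 2 = 0 := by have h := hent 2 2; simpa using h
  have h20 : X 2 0 = conj (X 0 2) := hherm 0 2
  have h21 : X 2 1 = conj (X 1 2) := hherm 1 2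
  ext i j
  fin_cases i <;> fin_cases j <;> simp [h00, h01, h10, h11, h22, h20, h21]

/-- **`𝔤 = 𝔨 + 𝔭` (Cartan decomposition of `𝔲(2,1)`).** Every `X ∈ 𝔲(2,1)` is `K + X_c` with
`K = ½(X - Xᴴ) ∈ 𝔨` and `X_c = ½(X + Xᴴ) ∈ 𝔭`. Knapp 2002, VI.§2, (6.25)
(`𝔤₀ = 𝔨₀ ⊕ 𝔭₀`). [cite: Knapp2002, VI.§2 (6.25)] -/
theorem exists_mem_compactLie_add_pMat {X : Matrix (Fin 3) (Fin 3) ℂ} (hX : X ∈ u21Lie) :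
    ∃ K ∈ u21Group.compactLie, ∃ c : Fin 2 → ℂ, X = K + pMat c := by
  have hsum : X + Xᴴ ∈ u21Lie := u21Lie.add_mem hX (conjTranspose_mem_u21Lie hX)
  have hH : (X + Xᴴ)ᴴ = X + Xᴴ := by
    rw [Matrix.conjTranspose_add, Matrix.conjTranspose_conjTranspose, add_comm]
  have hp := eq_pMat_of_conjTranspose_eq hsum hH
  refine ⟨(1 / 2 : ℝ) • (X - Xᴴ), u21Group.compactLie.smul_mem _ (sub_conjTranspose_mem_compactLie hX),
    (1 / 2 : ℝ) • ![(X + Xᴴ) 0 2, (X + Xᴴ) 1 2], ?_⟩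
  rw [pMat_smul, ← hp, ← smul_add, sub_add_add_cancel, ← two_smul ℝ X, smul_smul]
  norm_num

/-- **`[𝔭, 𝔭] ⊆ 𝔨`**: for `b, c ∈ ℂ²` the commutator `X_b X_c - X_c X_b` lies in `𝔨` (it is in
`𝔲(2,1)`, a Lie subalgebra, and it is skew-Hermitian because `X_b`, `X_c` are Hermitian).
Knapp 2002, VI.§2, (6.26) (`[𝔭₀, 𝔭₀] ⊆ 𝔨₀`). [cite: Knapp2002, VI.§2 (6.26)] -/
theorem pMat_mul_sub_mul_mem_compactLie (b c : Fin 2 → ℂ) :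
    pMat b * pMat c - pMat c * pMat b ∈ u21Group.compactLie := by
  rw [RealMatrixGroup.mem_compactLie_iff, u21Group_lie]
  refine ⟨u21Lie.lie_mem (pMat_skew b) (pMat_skew c), ?_⟩
  rw [Matrix.star_eq_conjTranspose, Matrix.conjTranspose_sub, Matrix.conjTranspose_mul,
    Matrix.conjTranspose_mul, conjTranspose_pMat, conjTranspose_pMat, neg_sub]

/-- The bracket of two elements of `𝔭` read in the Lie algebra of `u21Group`:
`(⁅X_b, X_c⁆ : 𝔲(2,1))` has matrix `X_b X_c - X_c X_b`, an element of `𝔨`. [cite: Knapp2002, VI.§2 (6.26)] -/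
theorem coe_lie_liePMat_mem_compactLie (b c : Fin 2 → ℂ) :
    ((⁅liePMat b, liePMat c⁆ : u21Group.lie) : Matrix (Fin 3) (Fin 3) ℂ) ∈ u21Group.compactLie := by
  rw [LieSubalgebra.coe_bracket, coe_liePMat, coe_liePMat, Ring.lie_def]
  exact pMat_mul_sub_mul_mem_compactLie b c

/-- `b ↦ X_b` is additive in the Lie algebra of `u21Group`. [cite: Knapp2002, I.§1 Example (3)] -/
theorem liePMat_add (b c : Fin 2 → ℂ) : liePMat (b + c) = liePMat b + liePMat c :=
  Subtype.ext (pMat_add b c)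

/-- Real coordinates on `𝔭 ≅ ℂ²`: `X_c = ∑ⱼ Re(cⱼ) X_{eⱼ} + Im(cⱼ) X_{i eⱼ}`. [cite: Knapp2002, VI.§2 (6.25)] -/
theorem liePMat_eq_sum (c : Fin 2 → ℂ) :
    liePMat c = ∑ j : Fin 2, ((c j).re • liePMat (Pi.single j 1) +
      (c j).im • liePMat (Complex.I • Pi.single j 1)) := by
  have hc : c = ∑ j : Fin 2, (((c j).re • (Pi.single j (1 : ℂ) : Fin 2 → ℂ) +
      (c j).im • (Complex.I • (Pi.single j (1 : ℂ) : Fin 2 → ℂ)) : Fin 2 → ℂ)) := by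
    funext k
    simp only [Finset.sum_apply, Pi.add_apply, Pi.smul_apply, Pi.single_apply, Fin.sum_univ_two,
      smul_eq_mul, Complex.real_smul]
    fin_cases k <;> simp [Complex.re_add_im, mul_comm Complex.I]
  -- `liePMat` of a finite sum
  have hsum : ∀ (s : Finset (Fin 2)) (f : Fin 2 → (Fin 2 → ℂ)),
      liePMat (∑ j ∈ s, f j) = ∑ j ∈ s, liePMat (f j) := by
    intro s f
    induction s using Finset.induction_on with
    | empty =>
      simp only [Finset.sum_empty]
      exact Subtype.ext (by rw [coe_liePMat, pMat_zero]; rfl)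
    | insert a s ha ih => rw [Finset.sum_insert ha, Finset.sum_insert ha, liePMat_add, ih]
  conv_lhs => rw [hc]
  rw [hsum]
  refine Finset.sum_congr rfl fun j _ => ?_
  rw [liePMat_add, ← smul_liePMat, ← smul_liePMat]

/-! ### 2. The frame consumed by Nelson's method -/

/-- **A real frame of `𝔲(2,1)` adapted to `𝔨 ⊕ 𝔭`.** There is a finite family `Y_a` of elements
of `𝔨` spanning `𝔨` over `ℝ` (a basis of the `5`-dimensional `𝔨 = 𝔲(2) ⊕ 𝔲(1)`), such that the
`Y_a` together with `P_j = X_{e_j}`, `Q_j = X_{i e_j}` (`j = 0, 1`; a real basis of `𝔭 ≅ ℂ²`)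
span `𝔲(2,1)` over `ℝ` (`𝔤 = 𝔨 ⊕ 𝔭`), and every bracket `⁅X_b, X_c⁆` lies in the real span of
the `Y_a` (`[𝔭, 𝔭] ⊆ 𝔨`). This is the input `(Y, P, Q)` of
`Literature.NumberTheory.Automorphic.IsL2LieStable.analyticAt_rightRegular_toLp_of_null`.
Knapp 2002, VI.§2, (6.25)–(6.26). [cite: Knapp2002, VI.§2 (6.25)–(6.26)] -/
theorem exists_compactLie_frame :
    ∃ (n : ℕ) (Y : Fin n → u21Group.lie),
      (∀ a, (Y a : Matrix (Fin 3) (Fin 3) ℂ) ∈ u21Group.compactLie) ∧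
      (∀ Z : u21Group.lie, (Z : Matrix (Fin 3) (Fin 3) ℂ) ∈ u21Group.compactLie →
        Z ∈ Submodule.span ℝ (Set.range Y)) ∧
      Submodule.span ℝ (Set.range (Sum.elim Y (Sum.elim
        (fun j : Fin 2 => liePMat (Pi.single j 1))
        (fun j : Fin 2 => liePMat (Complex.I • Pi.single j 1))))) = ⊤ ∧
      (∀ b c : Fin 2 → ℂ, ⁅liePMat b, liePMat c⁆ ∈ Submodule.span ℝ (Set.range Y)) := by
  -- a real basis of `𝔨`
  set S : Submodule ℝ (Matrix (Fin 3) (Fin 3) ℂ) := u21Group.compactLie.toSubmodule with hS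
  have hSle : S ≤ u21Group.lie.toSubmodule := fun K hK => u21Group.compactLie_le_lie hK
  let incl : S →ₗ[ℝ] u21Group.lie.toSubmodule := Submodule.inclusion hSle
  let bK := Module.finBasis ℝ S
  let Y : Fin (Module.finrank ℝ S) → u21Group.lie := fun a => incl (bK a)
  have hYmem : ∀ a, (Y a : Matrix (Fin 3) (Fin 3) ℂ) ∈ u21Group.compactLie := fun a => (bK a).2
  have hYspan : ∀ Z : u21Group.lie, (Z : Matrix (Fin 3) (Fin 3) ℂ) ∈ u21Group.compactLie →
      Z ∈ Submodule.span ℝ (Set.range Y) := by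
    intro Z hZ
    let Z' : S := ⟨(Z : Matrix (Fin 3) (Fin 3) ℂ), hZ⟩
    have h1 : incl Z' ∈ (Submodule.span ℝ (Set.range bK)).map incl :=
      Submodule.mem_map_of_mem (bK.mem_span Z')
    rw [Submodule.map_span, ← Set.range_comp] at h1
    have h2 : incl Z' = Z := Subtype.ext rfl
    rw [h2] at h1
    exact h1
  refine ⟨Module.finrank ℝ S, Y, hYmem, hYspan, ?_, fun b c => hYspan _ (coe_lie_liePMat_mem_compactLie b c)⟩
  -- spanning: `X = ½(X - Xᴴ) + ½(X + Xᴴ)`, the first in `𝔨`, the second some `X_c`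
  rw [eq_top_iff]
  rintro Z -
  obtain ⟨K, hK, c, hc⟩ := exists_mem_compactLie_add_pMat (X := (Z : Matrix (Fin 3) (Fin 3) ℂ)) Z.2
  have hZ : Z = (⟨K, u21Group.compactLie_le_lie hK⟩ : u21Group.lie) + liePMat c :=
    Subtype.ext hc
  rw [hZ]
  refine Submodule.add_mem _ ?_ ?_
  · refine Submodule.span_mono ?_ (hYspan _ hK)
    rintro _ ⟨a, rfl⟩
    exact ⟨Sum.inl a, rfl⟩
  · rw [liePMat_eq_sum]
    refine Submodule.sum_mem _ fun j _ => Submodule.add_mem _ ?_ ?_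
    · exact Submodule.smul_mem _ _ (Submodule.subset_span ⟨Sum.inr (Sum.inl j), rfl⟩)
    · exact Submodule.smul_mem _ _ (Submodule.subset_span ⟨Sum.inr (Sum.inr j), rfl⟩)

/-! ### 3. The central element `z₀ = diag(i, i, 0)` of `𝔨` and the complex structure of `𝔭` -/

/-- `diag(i, i, 0) = (i/2)(1 + J)`. [cite: Knapp2002, VII.§9] -/
theorem z0_eq_smul_one_add_J :
    (Matrix.diagonal ![Complex.I, Complex.I, 0] : Matrix (Fin 3) (Fin 3) ℂ) =
      (Complex.I / 2) • (1 + J) := by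
  rw [J, ← Matrix.diagonal_one, Matrix.diagonal_add, ← Matrix.diagonal_smul]
  congr 1
  funext i
  fin_cases i <;> simp <;> ring

/-- `z₀ = diag(i, i, 0)` lies in `𝔨`: it is in `𝔲(2,1)` (diagonal, purely imaginary) and
skew-Hermitian. Knapp 2002, VII.§9 (the element of the centre of `𝔨` giving the complex
structure). [cite: Knapp2002, VII.§9] -/
theorem z0_mem_compactLie :
    (Matrix.diagonal ![Complex.I, Complex.I, 0] : Matrix (Fin 3) (Fin 3) ℂ) ∈ u21Group.compactLie := by
  have hH : (Matrix.diagonal ![Complex.I, Complex.I, 0] : Matrix (Fin 3) (Fin 3) ℂ)ᴴ =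
      -Matrix.diagonal ![Complex.I, Complex.I, 0] := by
    rw [Matrix.diagonal_conjTranspose, Matrix.diagonal_neg]
    congr 1
    funext i
    fin_cases i <;> simp
  rw [RealMatrixGroup.mem_compactLie_iff, u21Group_lie, mem_u21Lie_iff, Matrix.star_eq_conjTranspose, hH]
  refine ⟨?_, rfl⟩
  rw [J, Matrix.neg_mul, Matrix.diagonal_mul_diagonal, Matrix.diagonal_mul_diagonal, neg_add_eq_zero]
  congr 1
  funext i
  exact mul_comm _ _

/-- **`z₀` is central in `𝔨`**: `z₀ K = K z₀` for `K ∈ 𝔨` (`z₀ = (i/2)(1 + J)` and `J K = K J`).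
Knapp 2002, VII.§9. [cite: Knapp2002, VII.§9] -/
theorem z0_mul_eq_mul_z0_of_mem_compactLie {K : Matrix (Fin 3) (Fin 3) ℂ} (hK : K ∈ u21Group.compactLie) :
    Matrix.diagonal ![Complex.I, Complex.I, 0] * K = K * Matrix.diagonal ![Complex.I, Complex.I, 0] := by
  rw [z0_eq_smul_one_add_J, Matrix.smul_mul, Matrix.mul_smul, Matrix.add_mul, Matrix.mul_add,
    Matrix.one_mul, Matrix.mul_one, J_mul_eq_mul_J_of_mem_compactLie hK]

/-- **`ad z₀` is the complex structure of `𝔭`**: `z₀ X_b - X_b z₀ = X_{ib}`. Hence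
`𝔭^∓ = {X_b ± i X_{ib}}` are the `∓ i`-eigenspaces of `ad z₀` in `𝔭_ℂ` and a function killed by
`X_b + i X_{ib}` (Cauchy–Riemann, `UnitaryBallLieDerivative`) is killed by `𝔭⁻`.
Knapp 2002, VII.§9. [cite: Knapp2002, VII.§9] -/
theorem z0_mul_pMat_sub_pMat_mul_z0 (b : Fin 2 → ℂ) :
    Matrix.diagonal ![Complex.I, Complex.I, 0] * pMat b - pMat b * Matrix.diagonal ![Complex.I, Complex.I, 0] =
      pMat (Complex.I • b) := by
  ext i j
  rw [Matrix.sub_apply, Matrix.diagonal_mul, Matrix.mul_diagonal]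
  fin_cases i <;> fin_cases j <;> simp [pMat, mul_comm]

/-- `z₀` read in the Lie algebra of `u21Group` brackets `X_b` to `X_{ib}`. [cite: Knapp2002, VII.§9] -/
theorem lie_z0_liePMat (b : Fin 2 → ℂ) :
    ⁅(⟨Matrix.diagonal ![Complex.I, Complex.I, 0], u21Group.compactLie_le_lie z0_mem_compactLie⟩ : u21Group.lie),
      liePMat b⁆ = liePMat (Complex.I • b) :=
  Subtype.ext (by
    rw [LieSubalgebra.coe_bracket, coe_liePMat, coe_liePMat, Ring.lie_def]
    exact z0_mul_pMat_sub_pMat_mul_z0 b)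

/-! ### 4. `𝔨 = {Y ∈ 𝔲(2,1) : Y J = J Y}` (the block-diagonal description, both directions) -/

/-- Conversely, an element of `𝔲(2,1)` commuting with `J` is skew-Hermitian, hence lies in `𝔨`
(`Yᴴ J + J Y = 0` and `J Y = Y J` give `(Yᴴ + Y) J = 0`, and `J² = 1`). So
`𝔨 = {Y ∈ 𝔲(2,1) : Y J = J Y} = 𝔲(2) ⊕ 𝔲(1)`. Knapp 2002, I.§1 Example (3). [cite: Knapp2002, I.§1 Example (3)] -/
theorem mem_compactLie_of_mul_J_eq_J_mul {Y : Matrix (Fin 3) (Fin 3) ℂ} (hY : Y ∈ u21Lie)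
    (hJ : Y * J = J * Y) : Y ∈ u21Group.compactLie := by
  rw [RealMatrixGroup.mem_compactLie_iff, u21Group_lie, Matrix.star_eq_conjTranspose]
  refine ⟨hY, ?_⟩
  rw [mem_u21Lie_iff] at hY
  have h1 : (Yᴴ + Y) * J = 0 := by rw [Matrix.add_mul, hJ]; exact hY
  have h2 := congrArg (· * J) h1
  simp only [Matrix.mul_assoc, J_mul_J, Matrix.mul_one, Matrix.zero_mul] at h2
  exact eq_neg_of_add_eq_zero_left h2

/-- For `Y ∈ 𝔲(2,1)` (an element of the Lie algebra of `u21Group`): `Y ∈ 𝔨 ↔ Y J = J Y` — the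
bridge between the two spellings of `𝔨`-stability used downstream (`u21Group.compactLie`, resp.
`{Y : Y * J = J * Y}`). Knapp 2002, I.§1 Example (3). [cite: Knapp2002, I.§1 Example (3)] -/
theorem mem_compactLie_iff_mul_J_eq_J_mul (Y : u21Group.lie) :
    (Y : Matrix (Fin 3) (Fin 3) ℂ) ∈ u21Group.compactLie ↔
      (Y : Matrix (Fin 3) (Fin 3) ℂ) * J = J * (Y : Matrix (Fin 3) (Fin 3) ℂ) :=
  ⟨fun h => (J_mul_eq_mul_J_of_mem_compactLie h).symm, fun h => mem_compactLie_of_mul_J_eq_J_mul Y.2 h⟩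

end BallForms

end Literature.AlgebraicGeometry.ShimuraVarieties
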